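import Literature.Geometry.Kaehler.ComplexTorusLefschetzSL2Action
import Literature.Geometry.Kaehler.ComplexTorusWeylOperatorIntegral
import Literature.Geometry.Kaehler.ComplexTorusNeronSeveriLieAlgebraDefinedOverQ
import Literature.Geometry.Kaehler.ComplexTorusIntegralHardLefschetz
import Literature.AlgebraicGeometry.HodgeTheory.ComplexTorusIntegralHodgeClassesDividedPowersGeneral
import Mathlib.LinearAlgebra.Matrix.FixedDetMatrices
import HarnessLib

/-!
# Beauville's `SL₂`-action on the cohomology of a polarised complex torus: the RATIONAL structure `H•(X; ℚ)`, the Hodge ring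
# `⊕_p B^p(X)` and Looijenga–Lunts' Hodge algebra are `SL₂(ℚ)`-stable; `(1 n ; 0 1)` acts integrally for every integral `η`;
# for a PRINCIPAL polarisation the whole `SL₂(ℤ)` (Mukai) preserves `H•(X, ℤ)` and the integral Hodge lattice `⊕_p Hdg^p(X, ℤ)`

Layer `Literature/Geometry/Kaehler`, namespace `Literature.Geometry.Kaehler.ComplexTorus`; lane `lit-hodgefound` (Track 2 foundations
library), prover seat `lit-hodgefound-p09` (generation 52, row g52-#1). THEOREMS ONLY (no definition, no named fact, no instance, no
notation; D-0026 net debt `0`). Sequel of rows g51-#9 `ComplexTorusLefschetzSL2Action` (the four values of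
`ρ_η = (hasLefschetzProperty_lefschetzG hη).sl2Rep isZGrading_countingG : SL(2, ℂ) →* End_ℂ(H•(X; ℂ))`: `diag(t, t⁻¹) ↦ t^{k−g}`,
`(1 a ; 0 1) ↦ e^{aη} ∧ ·`, `(1 0 ; a 1) ↦ exp(a Λ_η)`, `(0 −1 ; 1 0) ↦ w = (−1)^g χ(d)⁻¹ φ^*F`) and g51-#5 `ComplexTorusWeylOperatorIntegral`
(`w : Hᵏ(X, ℤ) ⥲ H^{2g−k}(X, ℤ)` for a principal polarisation).

SETTING. `X = E/Φ(ℤ^ι)` a complex torus of dimension `g`, `H•(X; ℂ) = GForm E ℂ = Π_m Alt^m_ℝ(E; ℂ)` the carrier of all degrees,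
with its three lattices/structures of the tree: `H•(X; ℚ) = rationalFormsG Φ = Π_m H^m(X, ℚ)` (`rationalForms`), the stabiliser
`rationalEnd Φ = 𝔤𝔩(H•(X; ℚ)) ⊂ End_ℂ(H•(X; ℂ))`, Looijenga–Lunts' Hodge algebra `Hdg(X) = hodgeAlgebraG Φ` with stabiliser
`hodgeAlgebraEnd Φ`, the rational Hodge ring `⊕_p B^p(X) = hodgeClassesG Φ = H•(X; ℚ) ∩ Hdg(X)`
(`ComplexTorusNeronSeveriLieAlgebraDefinedOverQ`), and the INTEGRAL lattices written with Mathlib's `AddSubgroup.pi`: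
`H•(X, ℤ) = AddSubgroup.pi univ (integralForms Φ) = Π_m H^m(X, ℤ)` and `Hdg•(X, ℤ) = AddSubgroup.pi univ (m ↦ ⨆_p integralHodgeClassesIn Φ m p)`
(`Hdg^p(X, ℤ) = H^{2p}(X, ℤ) ∩ H^{p,p}` placed in degree `2p`). `η` a non-degenerate real `2`-form; `ρ = ρ_η` as above; along
`SL₂(ℤ) → SL₂(ℚ) → SL₂(ℂ)` (`Matrix.SpecialLinearGroup.map`) we read `ρ` on `SL₂(ℚ)` and on `SL₂(ℤ) = ⟨S, T⟩`
(Mathlib `ModularGroup.S = (0 −1 ; 1 0)`, `ModularGroup.T = (1 1 ; 0 1)`, `SpecialLinearGroup.SL2Z_generators`).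

## What is proved

* §0 lattice plumbing: `mem_pi_integralForms_iff`, `of_mem_pi_integralForms`, `apply_mem_pi_integralForms_of_forall_of` (an operator
  mapping every homogeneous integral class into `H•(X, ℤ)` maps `H•(X, ℤ)` into itself — every graded form is the finite sum of its
  components), the same for `Hdg•(X, ℤ)`; **`IsNSForm.inv_natCast_factorial_smul_lefschetzPow_mem_integralForms`: `η^{∧j}/j! ∧ y ∈ H(X, ℤ)`
  for `y ∈ H(X, ℤ)` and EVERY integral `η ∈ NS(X)`** (the divided power `η^{[j]} = η^{∧j}/j!` is an integral class,
  `divPowForm_mem_integralForms`), and `…_mem_integralHodgeClassesIn` (type `(j, j)` is `ℂ`-linear).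
* §1 **`sl2Rep_mem_hodgeAlgebraEnd`: every `γ ∈ SL₂(ℂ)` stabilises the Hodge algebra `Hdg(X)`** for `η ∈ NS_ℚ(X)` non-degenerate
  (`ρ(γ) ∈ ℂ[L_η, Λ_η]`, row g38-#1's `sl2Rep_mem_adjoin_pair_dual`, and `L_η`, `Λ_η` stabilise `Hdg(X)`).
* §2 RATIONALITY: `exp_ratCast_smul_mem_rationalEnd` (`exp(q·T)` is rational for `T` rational, `q ∈ ℚ`),
  **`sl2Rep_map_ratCast_mem_rationalEnd`: `ρ(SL₂(ℚ)) ⊆ GL(H•(X; ℚ))`** (transvection induction over the FIELD `ℚ`, Mathlib's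
  `Matrix.SL2.transvection_induction`: `ρ(1 q ; 0 1) = exp(q L_η)`, `ρ(1 0 ; q 1) = exp(q Λ_η)` are rational operators), hence
  `sl2Rep_map_ratCast_apply_mem_rationalFormsG` and **`sl2Rep_map_ratCast_apply_mem_hodgeClassesG`: the rational Hodge ring `⊕_p B^p(X)`
  is `SL₂(ℚ)`-stable** — Beauville's "representation of `SL₂` on [the `ℚ`-vector space] `CH(A)`" read on `H•(X; ℚ)` and on its Hodge
  classes; `SL₂(ℤ)`-forms `sl2Rep_map_intCast_mem_rationalEnd`, `…_apply_mem_hodgeClassesG`.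
* §3 INTEGRALITY OF THE GENERATORS: **`IsNSForm.sl2Rep_of_mem_pi_integralForms_of_coe_eq_upper`: `ρ(1 n ; 0 1)(Hᵏ(X, ℤ)) ⊆ H•(X, ℤ)`
  for every `n ∈ ℤ` and every integral non-degenerate `η`** (`e^{nη} ∧ x = Σⱼ nʲ η^{∧j}/j! ∧ x`), `…_integralHodgeClassesIn` (on `Hdg•(X, ℤ)`);
  **`IsPrincipalPolarization.sl2Rep_of_mem_pi_integralForms_of_coe_eq_weyl`: `ρ(0 −1 ; 1 0)(Hᵏ(X, ℤ)) ⊆ H^{2g−k}(X, ℤ)` for a principal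
  polarisation** (row g51-#5: `w = (−1)^g φ_H^*F` with Lange's `F : Hᵏ(X, ℤ) ⥲ H^{2g−k}(X̂, ℤ)`), `…_integralHodgeClassesIn`; general type
  `(d₁, …, d_g)`: `IsPolarizationType.prod_smul_sl2Rep_of_mem_pi_integralForms_of_coe_eq_weyl` (`d₁⋯d_g · ρ(0 −1 ; 1 0)` is integral).
* §4 **MUKAI–BEAUVILLE: `IsPrincipalPolarization.sl2Rep_map_intCast_apply_mem_pi_integralForms` — for a principally polarised complex torus
  the whole `SL₂(ℤ)` preserves `H•(X, ℤ)`**, and **`IsPrincipalPolarization.sl2Rep_map_intCast_apply_mem_pi_integralHodgeClassesIn` — it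
  preserves the integral Hodge lattice `⊕_p Hdg^p(X, ℤ)`** (`SL₂(ℤ) = ⟨S, T⟩`, `S⁻¹ = S³`, `T⁻¹ = S³TSTS`: Mathlib's `SL2Z_generators`,
  `ModularGroup.S_inv`, `ModularGroup.T_S_rel`; Mathlib's `Subgroup.closure_induction''`); values on the generators
  `IsPrincipalPolarization.sl2Rep_modularS_of_mem` (`S ↦ w`), `IsNSForm.sl2Rep_modularT_of` (`T ↦ e^{η} ∧ ·`).

## Sources, VERBATIM

* A. Beauville, *The action of SL₂ on abelian varieties*, J. Ramanujan Math. Soc. 25 (2010) [Beauville2010SL2], held text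
  `paper:arxiv-0805.1541`. §2 (p0003): "In [M] Mukai observes that the derived category `D(A)` of a principally polarized abelian variety
  `(A, θ)` carries an action of `SL₂(ℤ)` "up to shift". […] Recall that the group `SL₂(ℤ)` is generated by the elements `w = (0 −1 ; 1 0)`,
  `u = (1 1 ; 0 1)` with the relations `w² = (uw)³`, `w⁴ = 1`. […] define an action of `S̃L₂(ℤ)` on `D(A)` by mapping `ũ` to the functor
  `⊗ L` and `w̃` to `Φ_𝒫`. Theorem 3.13 of [M] gives `(Φ_𝒫)² = (⊗L ∘ Φ_𝒫)³ = (−1_A)^*[−g]` […] **Proposition** There is a (unique) group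
  homomorphism `SL₂(ℤ) → Corr(A)^*` mapping `u` to `Δ_* e^θ` and `w` to `d⁻¹ e^℘`." §4 (p0005): "**Theorem** Let `A` be an abelian variety,
  with a polarization `θ` of degree `d`. There is a representation of `SL₂` on `CH(A)` [a `ℚ`-vector space], which is a direct sum of
  finite-dimensional representations, such that […] `(0 −1 ; 1 0)·z = ℱ(z)`, `(1 a ; 0 1)·z = e^{aθ} z` […]" (Introduction: "the group `SL₂`
  acts on the `ℚ`-vector space `CH(A)`"; §1: "an automorphism of `D(A)` induces an automorphism of the K-theory group `K(A)`, hence […] of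
  `CH(A)` via the isomorphism `ch : K(A) ⊗ ℚ ⥲ CH(A)`").
* S. Mukai, *Duality between `D(X)` and `D(X̂)` with its application to Picard sheaves*, Nagoya Math. J. 81 (1981) [Mukai1981], §3 Thm. 3.13
  (the `SL(2, ℤ)`-action on `D(X)` of a principally polarised abelian variety, as quoted by Beauville).
* H. Lange, *Abelian Varieties over the Complex Numbers* (2023) [Lange2023AbelianVarietiesComplex], §6.2.4 Prop. 6.2.20 p. 310: "the
  restriction of `F` to `Hᵖ(X, ℤ)` is an isomorphism `Hᵖ(X, ℤ) → H^{2g−p}(X̂, ℤ)`"; §1.1.3 Lemma 1.1.17 / Exercise 1.1.6 (7)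
  (`Hᵏ(X, ℤ) = Altᵏ(Λ, ℤ)`, closed under `∧`); §2.5.3 Thm. 2.5.16, §4.2 (Poincaré's formula — the divided powers `θ^p/p!` are integral classes).
* E. Looijenga, V. A. Lunts, *A Lie algebra attached to a projective variety*, Invent. Math. 129 (1997) [LooijengaLunts1997], §1 (1.7)
  ("if `M` is defined over a subfield `ℚ ⊂ K` […] `𝔤(𝔞, M)` is as a Lie subalgebra of `𝔤𝔩(M)` also defined over `ℚ`"), §3 p. 16
  ("the Hodge algebra `Hdg(X) ⊂ H(X)` (i.e., the complex span of the rational part of `⊕ₖ H^{k,k}(X)`) is `𝔤_NS(X)`-invariant").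

## Neighbours (RULING 29 disclosure)

`Literature/AlgebraicGeometry/Motives/HodgeStructureFourierTransformSL2Action{,SelfAdjoint,Kunneth}` (seat p34, g38) integrate the
Lefschetz module `⋀W` over a FIELD `K` for a PRINCIPAL symplectic `ω` (`sl2Action ω g`; §6 there: `S ↦ ℱ`, `T ↦ e^θ ∧ ·` on `⋀W`). They
have no lattice, no rational structure inside a complex carrier and no Hodge classes; they are neither imported nor restated. The
present file lives on the torus-forms carrier `GForm E ℂ` of the p09 lineage with the tree's `integralForms` / `rationalForms` /
`integralHodgeClassesIn` / `hodgeClassesG`, for EVERY polarisation type where the statement allows it.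

## Scope

Cohomological shadow only (invariant forms); Beauville's statements are for Chow groups with `ℚ`-coefficients and Mukai's for `D(A)`;
what is proved here is exactly their realisation on `H•(X; ℚ)` and — new relative to both — on the integral lattices `H•(X, ℤ)`,
`⊕_p Hdg^p(X, ℤ)` of a principally polarised complex torus (for type `(d₁, …, d_g)` only `d₁⋯d_g · ρ(w)` is integral, §3).
-/

noncomputable section

-- `Module ℂ` / `SMulZeroClass ℂ` synthesis on `E [⋀^Fin k]→L[ℝ] ℂ` (as in `ComplexTorusLefschetzDecomposition`)
set_option maxSynthPendingDepth 3

namespace Literature.Geometry.Kaehler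

namespace ComplexTorus

open Module Function Finset
open scoped MatrixGroups
open Literature.LinearAlgebra.Alternating Literature.Algebra.Lie

universe uE

/-! ## §0 The lattices `H•(X, ℤ) = Π_m H^m(X, ℤ)` and `Hdg•(X, ℤ)` inside `H•(X; ℂ)`; divided powers `η^{∧j}/j! ∧ y` are integral -/

section Lattice

variable {ι : Type*} {E : Type uE} [NormedAddCommGroup E] [NormedSpace ℂ E] (Φ : (ι → ℝ) ≃L[ℝ] E) {η : E [⋀^Fin 2]→L[ℝ] ℝ}

/-- Membership in `H•(X, ℤ) = Π_m H^m(X, ℤ)`: every homogeneous component has integral periods.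
[cite: Lange2023AbelianVarietiesComplex, §1.1.3 Lemma 1.1.17] -/
theorem mem_pi_integralForms_iff {w : GForm E ℂ} :
    w ∈ AddSubgroup.pi Set.univ (integralForms Φ) ↔ ∀ m, w m ∈ integralForms Φ m := by
  simp only [AddSubgroup.mem_pi, Set.mem_univ, true_imp_iff]

/-- A homogeneous integral class lies in `H•(X, ℤ)`. [cite: Lange2023AbelianVarietiesComplex, §1.1.3 Lemma 1.1.17] -/
theorem of_mem_pi_integralForms {k : ℕ} {x : E [⋀^Fin k]→L[ℝ] ℂ} (hx : x ∈ integralForms Φ k) :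
    GForm.of k x ∈ AddSubgroup.pi Set.univ (integralForms Φ) := by
  rw [mem_pi_integralForms_iff]
  intro m
  rcases eq_or_ne m k with rfl | h
  · rwa [GForm.of_apply_self]
  · rw [GForm.of_apply_of_ne h]; exact zero_mem _

/-- Membership in the integral Hodge lattice `Hdg•(X, ℤ) = Π_m ⨆_p (H^m(X, ℤ) ∩ H^{p,p})`. [cite: Lange2023AbelianVarietiesComplex, §7.2.2] -/
theorem mem_pi_iSup_integralHodgeClassesIn_iff {w : GForm E ℂ} :
    w ∈ AddSubgroup.pi Set.univ (fun m ↦ ⨆ p, integralHodgeClassesIn Φ m p) ↔ ∀ m, w m ∈ ⨆ p, integralHodgeClassesIn Φ m p := by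
  simp only [AddSubgroup.mem_pi, Set.mem_univ, true_imp_iff]

/-- A homogeneous integral Hodge class lies in `Hdg•(X, ℤ)`. [cite: Lange2023AbelianVarietiesComplex, §7.2.2] -/
theorem of_mem_pi_iSup_integralHodgeClassesIn {m p : ℕ} {x : E [⋀^Fin m]→L[ℝ] ℂ} (hx : x ∈ integralHodgeClassesIn Φ m p) :
    GForm.of m x ∈ AddSubgroup.pi Set.univ (fun m ↦ ⨆ p, integralHodgeClassesIn Φ m p) := by
  rw [mem_pi_iSup_integralHodgeClassesIn_iff]
  intro m'
  rcases eq_or_ne m' m with rfl | h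
  · rw [GForm.of_apply_self]; exact AddSubgroup.mem_iSup_of_mem p hx
  · rw [GForm.of_apply_of_ne h]; exact zero_mem _

/-- `Hdg•(X, ℤ) ⊆ H•(X, ℤ)`. [cite: Lange2023AbelianVarietiesComplex, §7.2.2] -/
theorem pi_iSup_integralHodgeClassesIn_le_pi_integralForms :
    AddSubgroup.pi Set.univ (fun m ↦ ⨆ p, integralHodgeClassesIn Φ m p) ≤ AddSubgroup.pi Set.univ (integralForms Φ) := by
  intro w hw
  rw [mem_pi_integralForms_iff]
  intro m
  exact (iSup_le fun p ↦ integralHodgeClassesIn_le_integralForms Φ m p) ((mem_pi_iSup_integralHodgeClassesIn_iff Φ).1 hw m)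

variable [FiniteDimensional ℂ E]

/-- **An operator mapping every homogeneous integral class into `H•(X, ℤ)` maps `H•(X, ℤ)` into itself** (every graded form is the finite
sum of its homogeneous components of degree `≤ 2g`, `sum_range_of_eq`). [cite: Lange2023AbelianVarietiesComplex, §1.1.3 Lemma 1.1.17] -/
theorem apply_mem_pi_integralForms_of_forall_of (T : Module.End ℂ (GForm E ℂ))
    (hT : ∀ (k : ℕ) (x : E [⋀^Fin k]→L[ℝ] ℂ), x ∈ integralForms Φ k → T (GForm.of k x) ∈ AddSubgroup.pi Set.univ (integralForms Φ))
    {w : GForm E ℂ} (hw : w ∈ AddSubgroup.pi Set.univ (integralForms Φ)) : T w ∈ AddSubgroup.pi Set.univ (integralForms Φ) := by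
  rw [← sum_range_of_eq w, map_sum]
  exact sum_mem fun m _ ↦ hT m (w m) ((mem_pi_integralForms_iff Φ).1 hw m)

/-- The same for the integral Hodge lattice `Hdg•(X, ℤ)` (components are finite sums of integral Hodge classes).
[cite: Lange2023AbelianVarietiesComplex, §7.2.2] -/
theorem apply_mem_pi_iSup_integralHodgeClassesIn_of_forall_of (T : Module.End ℂ (GForm E ℂ))
    (hT : ∀ (m p : ℕ) (x : E [⋀^Fin m]→L[ℝ] ℂ), x ∈ integralHodgeClassesIn Φ m p →
      T (GForm.of m x) ∈ AddSubgroup.pi Set.univ (fun m ↦ ⨆ p, integralHodgeClassesIn Φ m p))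
    {w : GForm E ℂ} (hw : w ∈ AddSubgroup.pi Set.univ (fun m ↦ ⨆ p, integralHodgeClassesIn Φ m p)) :
    T w ∈ AddSubgroup.pi Set.univ (fun m ↦ ⨆ p, integralHodgeClassesIn Φ m p) := by
  rw [← sum_range_of_eq w, map_sum]
  refine sum_mem fun m _ ↦ ?_
  refine AddSubgroup.iSup_induction (fun p ↦ integralHodgeClassesIn Φ m p)
    (C := fun x ↦ T (GForm.of m x) ∈ AddSubgroup.pi Set.univ (fun m ↦ ⨆ p, integralHodgeClassesIn Φ m p))
    ((mem_pi_iSup_integralHodgeClassesIn_iff Φ).1 hw m) (fun p x hx ↦ hT m p x hx) ?_ fun x y hx hy ↦ ?_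
  · rw [GForm.of_zero, map_zero]; exact zero_mem _
  · rw [GForm.of_add, map_add]; exact add_mem hx hy

end Lattice

section DividedPowers

variable {ι : Type*} [Fintype ι] {E : Type uE} [NormedAddCommGroup E] [NormedSpace ℂ E] (Φ : (ι → ℝ) ≃L[ℝ] E) {η : E [⋀^Fin 2]→L[ℝ] ℝ}

/-- **`η^{∧j}/j! ∧ y ∈ Hᵏ(X, ℤ)` for `y ∈ Hᵐ(X, ℤ)` and EVERY integral `η ∈ NS(X)`** (`2j + m = k`): the divided power
`η^{[j]} = η^{∧j}/j!` is an integral class (`divPowForm_mem_integralForms` — on a symplectic basis `θ^{∧j}/j! = Σ_{#T=j} d_T dx_{T-pairs}`,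
Poincaré's formula) and `H•(X, ℤ) = Alt•(Λ, ℤ)` is closed under `∧`. This is the integrality of the unipotent `e^{η} ∧ ·` of Beauville's
`SL₂`. [cite: Lange2023AbelianVarietiesComplex, §2.5.3 Thm. 2.5.16 and §4.2 (Poincaré's formula); §1.1.3 Exercise 1.1.6 (7)]
[cite: Beauville2010SL2, §2 Proposition ("u ↦ Δ_* e^θ")] -/
theorem IsNSForm.inv_natCast_factorial_smul_lefschetzPow_mem_integralForms (hη : IsNSForm Φ η) (j : ℕ) {m k : ℕ} (h : 2 * j + m = k)
    {y : E [⋀^Fin m]→L[ℝ] ℂ} (hy : y ∈ integralForms Φ m) :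
    ((j.factorial : ℕ) : ℂ)⁻¹ • lefschetzPow η j h y ∈ integralForms Φ k := by
  subst h
  rw [lefschetzPow_apply, domDomCongr_finCongr_self, ← wedge_smul_left_complex, ← divPowForm_def]
  exact wedge_mem_integralForms Φ (divPowForm_mem_integralForms Φ (ofRealForm_mem_integralForms_two Φ hη) j) hy

/-- **`η^{∧j}/j! ∧ y ∈ Hdg^{j+i}(X, ℤ)` for `y ∈ Hdgⁱ(X, ℤ)`** (degrees `2j + m = k`): integral by the previous statement, of type
`(j + i, j + i)` because `η^{∧j} ∧ y` is and the type condition is `ℂ`-linear. [cite: Lange2023AbelianVarietiesComplex, §7.2.2; §2.5.3 Thm. 2.5.16]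
[cite: Beauville2010SL2, §2 Proposition] -/
theorem IsNSForm.inv_natCast_factorial_smul_lefschetzPow_mem_integralHodgeClassesIn (hη : IsNSForm Φ η) (j : ℕ) {m k i p : ℕ}
    (h : 2 * j + m = k) (hp : j + i = p) {y : E [⋀^Fin m]→L[ℝ] ℂ} (hy : y ∈ integralHodgeClassesIn Φ m i) :
    ((j.factorial : ℕ) : ℂ)⁻¹ • lefschetzPow η j h y ∈ integralHodgeClassesIn Φ k p := by
  rw [mem_integralHodgeClassesIn_iff]
  refine ⟨hη.inv_natCast_factorial_smul_lefschetzPow_mem_integralForms Φ j h hy.1, ?_⟩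
  subst h hp
  rw [lefschetzPow_apply, domDomCongr_finCongr_self]
  exact Submodule.smul_mem _ _ (wedgePow_wedge_mem_integralHodgeClassesIn Φ hη j hy).2

end DividedPowers

/-! ## §1 Every `γ ∈ SL₂(ℂ)` stabilises the Hodge algebra `Hdg(X)` -/

section HodgeAlgebra

variable {ι : Type*} [Fintype ι] [DecidableEq ι] {E : Type uE} [NormedAddCommGroup E] [NormedSpace ℂ E] [FiniteDimensional ℂ E]
  [Nontrivial E] (Φ : (ι → ℝ) ≃L[ℝ] E) {η : E [⋀^Fin 2]→L[ℝ] ℝ}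

/-- **`ρ(γ)(Hdg(X)) ⊆ Hdg(X)` for every `γ ∈ SL₂(ℂ)`** and every non-degenerate `η ∈ NS_ℚ(X)`: `ρ(γ) ∈ ℂ[L_η, Λ_η]`
(`sl2Rep_mem_adjoin_pair_dual`) and `L_η`, `Λ_η` stabilise Looijenga–Lunts' Hodge algebra (`lefschetzG_mem_hodgeAlgebraEnd`,
`lefschetzDualG_mem_hodgeAlgebraEnd`). [cite: LooijengaLunts1997, §3 p. 16 ("Hdg(X) … is 𝔤_NS(X)-invariant")] [cite: Beauville2010SL2, §4 Theorem] -/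
theorem sl2Rep_mem_hodgeAlgebraEnd (hQ : η ∈ neronSeveriQ Φ) (hη : ∀ v : E, v ≠ 0 → ∃ w : E, η ![v, w] ≠ 0) (γ : SL(2, ℂ)) :
    (hasLefschetzProperty_lefschetzG hη).sl2Rep isZGrading_countingG γ ∈ hodgeAlgebraEnd Φ := by
  have h := (hasLefschetzProperty_lefschetzG hη).sl2Rep_mem_adjoin_pair_dual isZGrading_countingG γ
  rw [dual_lefschetzG_eq_lefschetzDualG hη] at h
  refine (Algebra.adjoin_le ?_ : Algebra.adjoin ℂ _ ≤ hodgeAlgebraEnd Φ) h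
  rintro T (rfl | rfl)
  · exact lefschetzG_mem_hodgeAlgebraEnd Φ hQ
  · exact lefschetzDualG_mem_hodgeAlgebraEnd Φ hQ hη

/-- `ρ(γ) w ∈ Hdg(X)` for `w ∈ Hdg(X)`, `γ ∈ SL₂(ℂ)`. [cite: LooijengaLunts1997, §3 p. 16] [cite: Beauville2010SL2, §4 Theorem] -/
theorem sl2Rep_apply_mem_hodgeAlgebraG (hQ : η ∈ neronSeveriQ Φ) (hη : ∀ v : E, v ≠ 0 → ∃ w : E, η ![v, w] ≠ 0) (γ : SL(2, ℂ))
    {w : GForm E ℂ} (hw : w ∈ hodgeAlgebraG Φ) : (hasLefschetzProperty_lefschetzG hη).sl2Rep isZGrading_countingG γ w ∈ hodgeAlgebraG Φ :=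
  sl2Rep_mem_hodgeAlgebraEnd Φ hQ hη γ w hw

end HodgeAlgebra

/-! ## §2 Rationality: `ρ(SL₂(ℚ)) ⊆ GL(H•(X; ℚ))`; the rational Hodge ring is `SL₂(ℚ)`-stable -/

section Rational

variable {ι : Type*} [Fintype ι] [DecidableEq ι] {E : Type uE} [NormedAddCommGroup E] [NormedSpace ℂ E] [FiniteDimensional ℂ E]
  [Nontrivial E] (Φ : (ι → ℝ) ≃L[ℝ] E) {η : E [⋀^Fin 2]→L[ℝ] ℝ}

omit [Fintype ι] [DecidableEq ι] [FiniteDimensional ℂ E] [Nontrivial E] in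
/-- `(q : ℂ) • T` is a rational operator for `T` rational and `q ∈ ℚ`. [cite: LooijengaLunts1997, §1 (1.7)] -/
private theorem ratCast_complex_smul_mem_rationalEnd {T : Module.End ℂ (GForm E ℂ)} (hT : T ∈ rationalEnd Φ) (q : ℚ) :
    ((q : ℂ)) • T ∈ rationalEnd Φ := by
  have h := ratCast_smul_mem_rationalEnd Φ hT q
  rwa [← Complex.coe_smul, Complex.ofReal_ratCast] at h

omit [Fintype ι] [DecidableEq ι] [FiniteDimensional ℂ E] [Nontrivial E] in
/-- **`exp(q·T) ∈ 𝔤𝔩(H•(X; ℚ))` for a rational operator `T` and `q ∈ ℚ`** (Mathlib's finite exponential `IsNilpotent.exp`, a finite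
`ℚ`-combination of powers of `T`; the `ℚ`-algebra structure on `End_ℂ` through `ℚ → ℂ` as in row g38-#1). [cite: LooijengaLunts1997, §1 (1.7)]
[cite: Beauville2010SL2, §4 Theorem ("(1 a ; 0 1)·z = e^{aθ} z", a ∈ ℚ)] -/
theorem exp_ratCast_smul_mem_rationalEnd {T : Module.End ℂ (GForm E ℂ)} (hT : T ∈ rationalEnd Φ) (q : ℚ) :
    letI := Algebra.compHom (Module.End ℂ (GForm E ℂ)) (algebraMap ℚ ℂ)
    IsNilpotent.exp ((q : ℂ) • T) ∈ rationalEnd Φ := by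
  letI := Algebra.compHom (Module.End ℂ (GForm E ℂ)) (algebraMap ℚ ℂ)
  unfold IsNilpotent.exp
  refine Subalgebra.sum_mem _ fun i _ ↦ ?_
  change (algebraMap ℚ ℂ ((i.factorial : ℚ)⁻¹)) • ((q : ℂ) • T) ^ i ∈ rationalEnd Φ
  rw [eq_ratCast, smul_pow, ← Rat.cast_pow]
  exact ratCast_complex_smul_mem_rationalEnd Φ (ratCast_complex_smul_mem_rationalEnd Φ (pow_mem hT i) _) _

/-- **`ρ(SL₂(ℚ)) ⊆ GL(H•(X; ℚ))`**: for every non-degenerate `η ∈ NS_ℚ(X)` and every `γ ∈ SL₂(ℚ)` the operator `ρ(γ)` maps `H•(X; ℚ)`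
into itself — "a representation of [the `ℚ`-group] `SL₂` on [the `ℚ`-vector space] `CH(A)`", on rational cohomology. `SL₂(ℚ)` is generated by
its elementary unipotents (Mathlib's `Matrix.SL2.transvection_induction` over the field `ℚ`), which act by `exp(q L_η)`, `exp(q Λ_η)` with
`L_η`, `Λ_η` rational (`lefschetzG_mem_rationalEnd`, `lefschetzDualG_mem_rationalEnd`). [cite: Beauville2010SL2, §4 Theorem]
[cite: LooijengaLunts1997, §1 (1.7)] -/
theorem sl2Rep_map_ratCast_mem_rationalEnd (hQ : η ∈ neronSeveriQ Φ) (hη : ∀ v : E, v ≠ 0 → ∃ w : E, η ![v, w] ≠ 0) (γ : SL(2, ℚ)) :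
    (hasLefschetzProperty_lefschetzG hη).sl2Rep isZGrading_countingG (Matrix.SpecialLinearGroup.map (Rat.castHom ℂ) γ) ∈ rationalEnd Φ := by
  refine Matrix.SL2.transvection_induction
    (fun γ ↦ (hasLefschetzProperty_lefschetzG hη).sl2Rep isZGrading_countingG (Matrix.SpecialLinearGroup.map (Rat.castHom ℂ) γ) ∈ rationalEnd Φ)
    (fun i j hij c ↦ ?_) (fun A B hA hB ↦ by rw [map_mul, map_mul]; exact Subalgebra.mul_mem _ hA hB) γ
  fin_cases i <;> fin_cases j
  · exact absurd rfl hij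
  · have hc : ((Matrix.SpecialLinearGroup.map (Rat.castHom ℂ) (Matrix.SpecialLinearGroup.transvection hij c) : SL(2, ℂ)) :
        Matrix (Fin 2) (Fin 2) ℂ) = !![1, (c : ℂ); 0, 1] := by
      ext a b; fin_cases a <;> fin_cases b <;>
        simp [Matrix.SpecialLinearGroup.transvection, Matrix.transvection, Matrix.single]
    rw [(hasLefschetzProperty_lefschetzG hη).sl2Rep_apply_of_coe_eq_upper isZGrading_countingG _ hc]
    exact exp_ratCast_smul_mem_rationalEnd Φ (lefschetzG_mem_rationalEnd Φ (ofRealForm_mem_rationalForms_of_mem_neronSeveriQ Φ hQ)) c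
  · have hc : ((Matrix.SpecialLinearGroup.map (Rat.castHom ℂ) (Matrix.SpecialLinearGroup.transvection hij c) : SL(2, ℂ)) :
        Matrix (Fin 2) (Fin 2) ℂ) = !![1, 0; (c : ℂ), 1] := by
      ext a b; fin_cases a <;> fin_cases b <;>
        simp [Matrix.SpecialLinearGroup.transvection, Matrix.transvection, Matrix.single]
    rw [(hasLefschetzProperty_lefschetzG hη).sl2Rep_apply_of_coe_eq_lower isZGrading_countingG _ hc,
      dual_lefschetzG_eq_lefschetzDualG hη]
    exact exp_ratCast_smul_mem_rationalEnd Φ (lefschetzDualG_mem_rationalEnd Φ hQ hη) c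
  · exact absurd rfl hij

/-- `ρ(γ)(H•(X; ℚ)) ⊆ H•(X; ℚ)` for `γ ∈ SL₂(ℚ)` (element form). [cite: Beauville2010SL2, §4 Theorem] [cite: LooijengaLunts1997, §1 (1.7)] -/
theorem sl2Rep_map_ratCast_apply_mem_rationalFormsG (hQ : η ∈ neronSeveriQ Φ) (hη : ∀ v : E, v ≠ 0 → ∃ w : E, η ![v, w] ≠ 0)
    (γ : SL(2, ℚ)) {w : GForm E ℂ} (hw : w ∈ rationalFormsG Φ) :
    (hasLefschetzProperty_lefschetzG hη).sl2Rep isZGrading_countingG (Matrix.SpecialLinearGroup.map (Rat.castHom ℂ) γ) w ∈ rationalFormsG Φ :=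
  sl2Rep_map_ratCast_mem_rationalEnd Φ hQ hη γ w hw

/-- **THE RATIONAL HODGE RING `⊕_p B^p(X) = ⊕_p (H^{2p}(X, ℚ) ∩ H^{p,p})` IS `SL₂(ℚ)`-STABLE** (`η ∈ NS_ℚ(X)` non-degenerate): `ρ(γ)` is a
rational operator (above) stabilising the Hodge algebra (§1), and `⊕_p B^p(X) = H•(X; ℚ) ∩ Hdg(X)`. In particular the Lefschetz `SL₂` of a
polarisation permutes the Hodge classes of an abelian variety among themselves in all codimensions at once.
[cite: Beauville2010SL2, §4 Theorem] [cite: LooijengaLunts1997, §3 p. 16] [cite: Lange2023AbelianVarietiesComplex, §7.2.2] -/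
theorem sl2Rep_map_ratCast_apply_mem_hodgeClassesG (hQ : η ∈ neronSeveriQ Φ) (hη : ∀ v : E, v ≠ 0 → ∃ w : E, η ![v, w] ≠ 0)
    (γ : SL(2, ℚ)) {w : GForm E ℂ} (hw : w ∈ hodgeClassesG Φ) :
    (hasLefschetzProperty_lefschetzG hη).sl2Rep isZGrading_countingG (Matrix.SpecialLinearGroup.map (Rat.castHom ℂ) γ) w ∈ hodgeClassesG Φ := by
  rw [mem_hodgeClassesG_iff_mem_rationalFormsG_and_mem_hodgeAlgebraG] at hw ⊢
  exact ⟨sl2Rep_map_ratCast_mem_rationalEnd Φ hQ hη γ w hw.1, sl2Rep_mem_hodgeAlgebraEnd Φ hQ hη _ w hw.2⟩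

omit [Fintype ι] [DecidableEq ι] [FiniteDimensional ℂ E] [Nontrivial E] in
/-- `SL₂(ℤ) → SL₂(ℂ)` factors through `SL₂(ℚ)`. [folklore] -/
private theorem map_intCast_eq_map_ratCast_map (γ : SL(2, ℤ)) :
    (γ : SL(2, ℂ)) = Matrix.SpecialLinearGroup.map (Rat.castHom ℂ) (Matrix.SpecialLinearGroup.map (Int.castRingHom ℚ) γ) := by
  ext i j
  simp

/-- `ρ(SL₂(ℤ)) ⊆ GL(H•(X; ℚ))` (through `SL₂(ℤ) → SL₂(ℚ)`). [cite: Beauville2010SL2, §2 Proposition and §4 Theorem] -/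
theorem sl2Rep_map_intCast_mem_rationalEnd (hQ : η ∈ neronSeveriQ Φ) (hη : ∀ v : E, v ≠ 0 → ∃ w : E, η ![v, w] ≠ 0) (γ : SL(2, ℤ)) :
    (hasLefschetzProperty_lefschetzG hη).sl2Rep isZGrading_countingG (γ : SL(2, ℂ)) ∈ rationalEnd Φ := by
  rw [map_intCast_eq_map_ratCast_map]
  exact sl2Rep_map_ratCast_mem_rationalEnd Φ hQ hη _

/-- The rational Hodge ring is `SL₂(ℤ)`-stable. [cite: Beauville2010SL2, §2 Proposition and §4 Theorem] [cite: LooijengaLunts1997, §3 p. 16] -/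
theorem sl2Rep_map_intCast_apply_mem_hodgeClassesG (hQ : η ∈ neronSeveriQ Φ) (hη : ∀ v : E, v ≠ 0 → ∃ w : E, η ![v, w] ≠ 0)
    (γ : SL(2, ℤ)) {w : GForm E ℂ} (hw : w ∈ hodgeClassesG Φ) :
    (hasLefschetzProperty_lefschetzG hη).sl2Rep isZGrading_countingG (γ : SL(2, ℂ)) w ∈ hodgeClassesG Φ := by
  rw [map_intCast_eq_map_ratCast_map]
  exact sl2Rep_map_ratCast_apply_mem_hodgeClassesG Φ hQ hη _ hw

end Rational

/-! ## §3 Integrality of the generators: `(1 n ; 0 1)` for every integral `η`, `(0 −1 ; 1 0)` for a principal polarisation -/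

section Generators

variable {ι : Type*} [Fintype ι] [LinearOrder ι] {E : Type uE} [NormedAddCommGroup E] [NormedSpace ℂ E] [FiniteDimensional ℂ E]
  [Nontrivial E] (Φ : (ι → ℝ) ≃L[ℝ] E) {η : E [⋀^Fin 2]→L[ℝ] ℝ} {G : Matrix ι ι ℤ} {N : ℕ}

omit [LinearOrder ι] in
/-- **`ρ(1 n ; 0 1)(Hᵏ(X, ℤ)) ⊆ H•(X, ℤ)` for every `n ∈ ℤ` and every integral non-degenerate `η ∈ NS(X)`**: `(1 n ; 0 1)·x = e^{nη} ∧ x =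
Σⱼ nʲ (η^{∧j}/j!) ∧ x` (row g51-#9 `sl2Rep_upper_of`) and each `η^{∧j}/j! ∧ x` is integral (§0). No principal-polarisation hypothesis is
needed for the upper unipotents. [cite: Beauville2010SL2, §2 Proposition ("u ↦ Δ_* e^θ") and §4 Theorem ("(1 a ; 0 1)·z = e^{aθ} z")]
[cite: Lange2023AbelianVarietiesComplex, §2.5.3 Thm. 2.5.16; §1.1.3 Exercise 1.1.6 (7)] -/
theorem IsNSForm.sl2Rep_of_mem_pi_integralForms_of_coe_eq_upper (hNS : IsNSForm Φ η) (hη : ∀ v : E, v ≠ 0 → ∃ w : E, η ![v, w] ≠ 0)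
    (γ : SL(2, ℂ)) {n : ℤ} (hγ : (γ : Matrix (Fin 2) (Fin 2) ℂ) = !![1, (n : ℂ); 0, 1]) {k : ℕ} {x : E [⋀^Fin k]→L[ℝ] ℂ}
    (hx : x ∈ integralForms Φ k) :
    (hasLefschetzProperty_lefschetzG hη).sl2Rep isZGrading_countingG γ (GForm.of k x) ∈ AddSubgroup.pi Set.univ (integralForms Φ) := by
  rw [sl2Rep_upper_of hη γ hγ k x]
  refine sum_mem fun j _ ↦ ?_
  rw [← GForm.of_smul, mul_comm (((j.factorial : ℕ) : ℂ)⁻¹) ((n : ℂ) ^ j), mul_smul, ← Int.cast_pow, Int.cast_smul_eq_zsmul]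
  exact of_mem_pi_integralForms Φ (zsmul_mem (hNS.inv_natCast_factorial_smul_lefschetzPow_mem_integralForms Φ j rfl hx) _)

omit [LinearOrder ι] in
/-- **`ρ(1 n ; 0 1)(Hdgⁱ(X, ℤ)) ⊆ Hdg•(X, ℤ)`** (`n ∈ ℤ`, `η ∈ NS(X)` integral non-degenerate; homogeneous pieces `x ∈ H^m(X, ℤ) ∩ H^{i,i}`).
[cite: Beauville2010SL2, §2 Proposition and §4 Theorem] [cite: Lange2023AbelianVarietiesComplex, §7.2.2] -/
theorem IsNSForm.sl2Rep_of_mem_pi_iSup_integralHodgeClassesIn_of_coe_eq_upper (hNS : IsNSForm Φ η)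
    (hη : ∀ v : E, v ≠ 0 → ∃ w : E, η ![v, w] ≠ 0) (γ : SL(2, ℂ)) {n : ℤ} (hγ : (γ : Matrix (Fin 2) (Fin 2) ℂ) = !![1, (n : ℂ); 0, 1])
    {m i : ℕ} {x : E [⋀^Fin m]→L[ℝ] ℂ} (hx : x ∈ integralHodgeClassesIn Φ m i) :
    (hasLefschetzProperty_lefschetzG hη).sl2Rep isZGrading_countingG γ (GForm.of m x) ∈
      AddSubgroup.pi Set.univ (fun m ↦ ⨆ p, integralHodgeClassesIn Φ m p) := by
  rw [sl2Rep_upper_of hη γ hγ m x]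
  refine sum_mem fun j _ ↦ ?_
  rw [← GForm.of_smul, mul_comm (((j.factorial : ℕ) : ℂ)⁻¹) ((n : ℂ) ^ j), mul_smul, ← Int.cast_pow, Int.cast_smul_eq_zsmul]
  exact of_mem_pi_iSup_integralHodgeClassesIn Φ
    (zsmul_mem (hNS.inv_natCast_factorial_smul_lefschetzPow_mem_integralHodgeClassesIn Φ j rfl rfl hx) _)

include Φ in
omit [LinearOrder ι] [Nontrivial E] in
/-- Forms of degree `> 2g = rk Λ` vanish. [cite: Lange2023AbelianVarietiesComplex, §1.1.3 Cor. 1.1.19] -/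
private theorem eq_zero_of_card_lt₆₁ {k : ℕ} (x : E [⋀^Fin k]→L[ℝ] ℂ) (hk : Fintype.card ι < k) : x = 0 := by
  refine eq_zero_of_finrank_real_lt x ?_
  have h := finrank_complex_mul_two Φ (Fintype.equivFin ι).symm
  rw [finrank_real_of_complex]
  omega

/-- **`ρ(0 −1 ; 1 0)(Hᵏ(X, ℤ)) ⊆ H^{2g−k}(X, ℤ)` for a PRINCIPAL polarisation**: the Weyl element acts by `w = (−1)^g φ_H^* ∘ F`, which is
integral (row g51-#5 `IsPrincipalPolarization.exists_mem_integralForms_weylOperator_of_eq`: Lange's `F : Hᵏ(X, ℤ) ⥲ H^{2g−k}(X̂, ℤ)` and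
`φ_H : Λ ⥲ Λ̂`). [cite: Beauville2010SL2, §2 Proposition ("w ↦ d⁻¹ e^℘", d = 1) and §4 Theorem ("(0 −1 ; 1 0)·z = ℱ(z)")]
[cite: Lange2023AbelianVarietiesComplex, §6.2.4 Prop. 6.2.20 p. 310] [cite: Mukai1981, §3 Thm. 3.13] -/
theorem IsPrincipalPolarization.sl2Rep_of_mem_pi_integralForms_of_coe_eq_weyl (hp : IsPrincipalPolarization Φ η)
    (hη : ∀ v : E, v ≠ 0 → ∃ w : E, η ![v, w] ≠ 0) (γ : SL(2, ℂ)) (hγ : (γ : Matrix (Fin 2) (Fin 2) ℂ) = !![0, -1; 1, 0]) {k : ℕ}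
    {x : E [⋀^Fin k]→L[ℝ] ℂ} (hx : x ∈ integralForms Φ k) :
    (hasLefschetzProperty_lefschetzG hη).sl2Rep isZGrading_countingG γ (GForm.of k x) ∈ AddSubgroup.pi Set.univ (integralForms Φ) := by
  obtain ⟨G, hG⟩ := hp.isRiemannForm.exists_intMatrix_latticeGram
  rw [(hasLefschetzProperty_lefschetzG hη).sl2Rep_apply_of_coe_eq_weyl isZGrading_countingG γ hγ]
  by_cases hk : k ≤ Fintype.card ι
  · obtain ⟨y, hy, hxy⟩ := hp.exists_mem_integralForms_weylOperator_of_eq Φ hη hG (Fintype.equivFin ι).symm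
      (Nat.add_sub_cancel' hk) hx
    rw [hxy]
    exact of_mem_pi_integralForms Φ hy
  · rw [eq_zero_of_card_lt₆₁ Φ x (not_le.1 hk), GForm.of_zero, map_zero]
    exact zero_mem _

/-- **`ρ(0 −1 ; 1 0)(Hdgⁱ(X, ℤ)) ⊆ Hdg^{g−i}(X, ℤ)` for a principal polarisation** (row g51-#5: `w : Hdg^{2p}(X, ℤ) ⥲ Hdg^{2g−2p}(X, ℤ)`;
homogeneous pieces `x ∈ H^m(X, ℤ) ∩ H^{i,i}`, zero unless `m = 2i`). [cite: Beauville2010SL2, §2 Proposition and §4 Theorem]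
[cite: Lange2023AbelianVarietiesComplex, §6.2.4 Prop. 6.2.20 p. 310, Prop. 6.2.21 p. 311] [cite: Beauville1983FourierChow, §1 Prop. 1 (p. 241)] -/
theorem IsPrincipalPolarization.sl2Rep_of_mem_pi_iSup_integralHodgeClassesIn_of_coe_eq_weyl (hp : IsPrincipalPolarization Φ η)
    (hη : ∀ v : E, v ≠ 0 → ∃ w : E, η ![v, w] ≠ 0) (γ : SL(2, ℂ)) (hγ : (γ : Matrix (Fin 2) (Fin 2) ℂ) = !![0, -1; 1, 0]) {m i : ℕ}
    {x : E [⋀^Fin m]→L[ℝ] ℂ} (hx : x ∈ integralHodgeClassesIn Φ m i) :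
    (hasLefschetzProperty_lefschetzG hη).sl2Rep isZGrading_countingG γ (GForm.of m x) ∈
      AddSubgroup.pi Set.univ (fun m ↦ ⨆ p, integralHodgeClassesIn Φ m p) := by
  obtain ⟨G, hG⟩ := hp.isRiemannForm.exists_intMatrix_latticeGram
  rw [(hasLefschetzProperty_lefschetzG hη).sl2Rep_apply_of_coe_eq_weyl isZGrading_countingG γ hγ]
  by_cases him : i + i = m
  · have hm : m = 2 * i := by omega
    by_cases hi : i ≤ finrank ℂ E
    · have hcard := finrank_complex_mul_two Φ (Fintype.equivFin ι).symm
      have hx' : x.domDomCongr (finCongr hm) ∈ integralHodgeClasses Φ i := (domDomCongr_mem_integralHodgeClassesIn_iff Φ hm i x).2 hx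
      obtain ⟨y, hy, hxy⟩ := hp.exists_mem_integralHodgeClasses_weylOperator_of_eq Φ hη hG (Fintype.equivFin ι).symm
        (show 2 * i + 2 * (finrank ℂ E - i) = Fintype.card ι by omega) hx'
      rw [GForm.of_domDomCongr_finCongr hm] at hxy
      rw [hxy]
      exact of_mem_pi_iSup_integralHodgeClassesIn Φ hy
    · have hcard := finrank_complex_mul_two Φ (Fintype.equivFin ι).symm
      rw [eq_zero_of_card_lt₆₁ Φ x (by omega), GForm.of_zero, map_zero]
      exact zero_mem _
  · rw [integralHodgeClassesIn_eq_bot_of_ne Φ him, AddSubgroup.mem_bot] at hx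
    rw [hx, GForm.of_zero, map_zero]
    exact zero_mem _

omit [LinearOrder ι] in
/-- **Type `(d₁, …, d_g)`: `d₁⋯d_g · ρ(0 −1 ; 1 0)(Hᵏ(X, ℤ)) ⊆ H^{2g−k}(X, ℤ)`** — for a non-principal polarisation the Weyl element is
integral only after clearing the denominator `χ(d) = d₁⋯d_g` (`w = (−1)^g χ(d)⁻¹ φ_H^*F`, row g51-#5), Beauville's `w ↦ d⁻¹ e^℘`.
[cite: Beauville2010SL2, §2 Proposition ("w ↦ d⁻¹ e^℘")] [cite: Lange2023AbelianVarietiesComplex, §6.2.4 Prop. 6.2.20 p. 310]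
[cite: Polishchuk2007FourierStable, §1 Lemma 1.4 (p. 3)] -/
theorem IsPolarizationType.prod_smul_sl2Rep_of_mem_pi_integralForms_of_coe_eq_weyl [LinearOrder ι] (hR : IsRiemannForm Φ η) {g : ℕ}
    {d : Fin g → ℕ} (hd : IsPolarizationType Φ η d) (hη : ∀ v : E, v ≠ 0 → ∃ w : E, η ![v, w] ≠ 0)
    (hG : G.map (Int.cast : ℤ → ℝ) = latticeGram Φ η) (e : Fin N ≃ ι) (γ : SL(2, ℂ)) (hγ : (γ : Matrix (Fin 2) (Fin 2) ℂ) = !![0, -1; 1, 0])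
    {k m : ℕ} (h : k + m = N) {x : E [⋀^Fin k]→L[ℝ] ℂ} (hx : x ∈ integralForms Φ k) :
    (∏ i, (d i : ℂ)) • (hasLefschetzProperty_lefschetzG hη).sl2Rep isZGrading_countingG γ (GForm.of k x) ∈
      AddSubgroup.pi Set.univ (integralForms Φ) := by
  rw [(hasLefschetzProperty_lefschetzG hη).sl2Rep_apply_of_coe_eq_weyl isZGrading_countingG γ hγ]
  obtain ⟨y, hy, hxy⟩ := hd.exists_mem_integralForms_prod_smul_weylOperator_of_eq Φ hR hη hG e h hx
  rw [hxy]
  exact of_mem_pi_integralForms Φ hy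

end Generators

/-! ## §4 Mukai–Beauville: for a principal polarisation `SL₂(ℤ)` preserves `H•(X, ℤ)` and `⊕_p Hdg^p(X, ℤ)` -/

section Modular

variable {ι : Type*} [Fintype ι] [LinearOrder ι] {E : Type uE} [NormedAddCommGroup E] [NormedSpace ℂ E] [FiniteDimensional ℂ E]
  [Nontrivial E] (Φ : (ι → ℝ) ≃L[ℝ] E) {η : E [⋀^Fin 2]→L[ℝ] ℝ}

omit [Fintype ι] [LinearOrder ι] [NormedAddCommGroup E] [NormedSpace ℂ E] [FiniteDimensional ℂ E] [Nontrivial E] in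
/-- The image of `T = (1 1 ; 0 1)` in `SL₂(ℂ)`. [folklore] -/
private theorem coe_modularT₆₁ : (((ModularGroup.T : SL(2, ℤ)) : SL(2, ℂ)) : Matrix (Fin 2) (Fin 2) ℂ) = !![1, ((1 : ℤ) : ℂ); 0, 1] := by
  rw [Matrix.SpecialLinearGroup.coe_matrix_coe, ModularGroup.coe_T]
  ext i j; fin_cases i <;> fin_cases j <;> simp

omit [Fintype ι] [LinearOrder ι] [NormedAddCommGroup E] [NormedSpace ℂ E] [FiniteDimensional ℂ E] [Nontrivial E] in
/-- The image of `S = (0 −1 ; 1 0)` in `SL₂(ℂ)`. [folklore] -/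
private theorem coe_modularS₆₁ : (((ModularGroup.S : SL(2, ℤ)) : SL(2, ℂ)) : Matrix (Fin 2) (Fin 2) ℂ) = !![0, -1; 1, 0] := by
  rw [Matrix.SpecialLinearGroup.coe_matrix_coe, ModularGroup.coe_S]
  ext i j; fin_cases i <;> fin_cases j <;> simp

omit [Fintype ι] [LinearOrder ι] [NormedAddCommGroup E] [NormedSpace ℂ E] [FiniteDimensional ℂ E] [Nontrivial E] in
/-- `S⁻¹ = S³` and `T⁻¹ = S³ T S T S` in `SL₂(ℤ)` (Mathlib: `S_inv`, `T_S_rel`). [folklore] -/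
private theorem modular_inv_words₆₁ :
    ModularGroup.S⁻¹ = ModularGroup.S * ModularGroup.S * ModularGroup.S ∧
      ModularGroup.T⁻¹ = ModularGroup.S * ModularGroup.S * ModularGroup.S * ModularGroup.T * ModularGroup.S * ModularGroup.T * ModularGroup.S := by
  constructor
  · ext i j; fin_cases i <;> fin_cases j <;> rfl
  · rw [← ModularGroup.T_S_rel]; simp only [smul_eq_mul, mul_assoc]

omit [Fintype ι] [LinearOrder ι] in
/-- **`T = (1 1 ; 0 1) ∈ SL₂(ℤ)` acts by `e^{η} ∧ ·`**: `ρ(T)(x) = Σⱼ η^{∧j}/j! ∧ x` for `x ∈ Hᵏ(X; ℂ)` (Beauville's `u ↦ Δ_* e^θ`; any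
non-degenerate `η`). [cite: Beauville2010SL2, §2 Proposition ("mapping u to Δ_* e^θ")] -/
theorem sl2Rep_modularT_of (hη : ∀ v : E, v ≠ 0 → ∃ w : E, η ![v, w] ≠ 0) (k : ℕ) (x : E [⋀^Fin k]→L[ℝ] ℂ) :
    (hasLefschetzProperty_lefschetzG hη).sl2Rep isZGrading_countingG ((ModularGroup.T : SL(2, ℤ)) : SL(2, ℂ)) (GForm.of k x) =
      ∑ j ∈ range (finrank ℂ E + 1), (((Nat.factorial j : ℕ) : ℂ)⁻¹) • GForm.of (2 * j + k) (lefschetzPow η j rfl x) := by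
  rw [sl2Rep_upper_of hη _ coe_modularT₆₁ k x]
  simp only [Int.cast_one, one_pow, mul_one]

/-- **`S = (0 −1 ; 1 0) ∈ SL₂(ℤ)` acts by the Weyl operator `w = (−1)^g φ_H^* ∘ F`** on the cohomology of a principally polarised complex torus:
`ρ(S)(x) = (−1)^g φ_H^*F(x)` placed in degree `2g − k` for `x ∈ Hᵏ(X; ℂ)` (Beauville's `w ↦ e^℘ = ℱ`, row g51-#9).
[cite: Beauville2010SL2, §2 Proposition ("w to d⁻¹e^℘") and §4 Theorem] [cite: Polishchuk2007FourierStable, §1 Lemma 1.4 (p. 3)] -/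
theorem IsPrincipalPolarization.sl2Rep_modularS_of {N : ℕ} (hp : IsPrincipalPolarization Φ η) (hη : ∀ v : E, v ≠ 0 → ∃ w : E, η ![v, w] ≠ 0)
    (e : Fin N ≃ ι) {k m : ℕ} (h : k + m = N) (x : E [⋀^Fin k]→L[ℝ] ℂ) :
    (hasLefschetzProperty_lefschetzG hη).sl2Rep isZGrading_countingG ((ModularGroup.S : SL(2, ℤ)) : SL(2, ℂ)) (GForm.of k x) =
      GForm.of m (((-1 : ℂ) ^ finrank ℂ E) •
        (fourierForm Φ e h x).compContinuousLinearMap ((phiHRep Φ hp.isRiemannForm.1).restrictScalars ℝ)) :=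
  hp.sl2Rep_weyl_of Φ hη e _ coe_modularS₆₁ h x

/-- **MUKAI–BEAUVILLE ON INTEGRAL COHOMOLOGY: for a principally polarised complex torus the `SL₂(ℤ)`-action preserves `H•(X, ℤ)`** —
`ρ(γ)(H•(X, ℤ)) ⊆ H•(X, ℤ)` for every `γ ∈ SL₂(ℤ)`. Proof as printed: `SL₂(ℤ) = ⟨w, u⟩` (Mathlib's `SL2Z_generators`), `u = T` acts by
`e^{η} ∧ ·` (integral, §3) and `w = S` by `(−1)^g φ_H^* F` (integral for `d = 1`, §3); `S⁻¹ = S³`, `T⁻¹ = S³TSTS`.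
[cite: Beauville2010SL2, §2 ("SL₂(ℤ) is generated by w, u"; Proposition "SL₂(ℤ) → Corr(A)^*, u ↦ Δ_*e^θ, w ↦ d⁻¹e^℘")]
[cite: Mukai1981, §3 Thm. 3.13] [cite: Lange2023AbelianVarietiesComplex, §6.2.4 Prop. 6.2.20 p. 310] -/
theorem IsPrincipalPolarization.sl2Rep_map_intCast_apply_mem_pi_integralForms (hp : IsPrincipalPolarization Φ η)
    (hη : ∀ v : E, v ≠ 0 → ∃ w : E, η ![v, w] ≠ 0) (γ : SL(2, ℤ)) {w : GForm E ℂ} (hw : w ∈ AddSubgroup.pi Set.univ (integralForms Φ)) :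
    (hasLefschetzProperty_lefschetzG hη).sl2Rep isZGrading_countingG (γ : SL(2, ℂ)) w ∈ AddSubgroup.pi Set.univ (integralForms Φ) := by
  have hNS : IsNSForm Φ η := hp.isRiemannForm.isNSForm
  -- the predicate "ρ(γ) preserves the lattice" is multiplicative
  have hS : ∀ w ∈ AddSubgroup.pi Set.univ (integralForms Φ), (hasLefschetzProperty_lefschetzG hη).sl2Rep isZGrading_countingG
      ((ModularGroup.S : SL(2, ℤ)) : SL(2, ℂ)) w ∈ AddSubgroup.pi Set.univ (integralForms Φ) := fun w hw ↦
    apply_mem_pi_integralForms_of_forall_of Φ _ (fun k x hx ↦ hp.sl2Rep_of_mem_pi_integralForms_of_coe_eq_weyl Φ hη _ coe_modularS₆₁ hx) hw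
  have hT : ∀ w ∈ AddSubgroup.pi Set.univ (integralForms Φ), (hasLefschetzProperty_lefschetzG hη).sl2Rep isZGrading_countingG
      ((ModularGroup.T : SL(2, ℤ)) : SL(2, ℂ)) w ∈ AddSubgroup.pi Set.univ (integralForms Φ) := fun w hw ↦
    apply_mem_pi_integralForms_of_forall_of Φ _ (fun k x hx ↦ hNS.sl2Rep_of_mem_pi_integralForms_of_coe_eq_upper Φ hη _ coe_modularT₆₁ hx) hw
  have hmul : ∀ a b : SL(2, ℤ),
      (∀ w ∈ AddSubgroup.pi Set.univ (integralForms Φ), (hasLefschetzProperty_lefschetzG hη).sl2Rep isZGrading_countingG (a : SL(2, ℂ)) w ∈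
        AddSubgroup.pi Set.univ (integralForms Φ)) →
      (∀ w ∈ AddSubgroup.pi Set.univ (integralForms Φ), (hasLefschetzProperty_lefschetzG hη).sl2Rep isZGrading_countingG (b : SL(2, ℂ)) w ∈
        AddSubgroup.pi Set.univ (integralForms Φ)) →
      ∀ w ∈ AddSubgroup.pi Set.univ (integralForms Φ), (hasLefschetzProperty_lefschetzG hη).sl2Rep isZGrading_countingG ((a * b : SL(2, ℤ)) : SL(2, ℂ)) w ∈
        AddSubgroup.pi Set.univ (integralForms Φ) := fun a b ha hb w hw ↦ by
    rw [show ((a * b : SL(2, ℤ)) : SL(2, ℂ)) = (a : SL(2, ℂ)) * (b : SL(2, ℂ)) from map_mul _ a b, map_mul, Module.End.mul_apply]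
    exact ha _ (hb w hw)
  have hmem : γ ∈ Subgroup.closure {ModularGroup.S, ModularGroup.T} := by
    rw [SpecialLinearGroup.SL2Z_generators]; exact Subgroup.mem_top γ
  have key : ∀ w ∈ AddSubgroup.pi Set.univ (integralForms Φ),
      (hasLefschetzProperty_lefschetzG hη).sl2Rep isZGrading_countingG (γ : SL(2, ℂ)) w ∈ AddSubgroup.pi Set.univ (integralForms Φ) := by
    refine Subgroup.closure_induction'' (p := fun (γ : SL(2, ℤ)) _ ↦ ∀ w ∈ AddSubgroup.pi Set.univ (integralForms Φ),
        (hasLefschetzProperty_lefschetzG hη).sl2Rep isZGrading_countingG (γ : SL(2, ℂ)) w ∈ AddSubgroup.pi Set.univ (integralForms Φ))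
      ?_ ?_ ?_ (fun a b _ _ ha hb ↦ hmul a b ha hb) hmem
    · rintro γ (rfl | rfl)
      · exact hS
      · exact hT
    · rintro γ (rfl | rfl)
      · rw [modular_inv_words₆₁.1]; exact hmul _ _ (hmul _ _ hS hS) hS
      · rw [modular_inv_words₆₁.2]; exact hmul _ _ (hmul _ _ (hmul _ _ (hmul _ _ (hmul _ _ (hmul _ _ hS hS) hS) hT) hS) hT) hS
    · intro w hw
      rw [show (((1 : SL(2, ℤ)) : SL(2, ℂ))) = 1 from map_one _, map_one, Module.End.one_apply]
      exact hw
  exact key w hw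

/-- **… AND PRESERVES THE INTEGRAL HODGE LATTICE `⊕_p Hdg^p(X, ℤ)`**: `ρ(γ)(Hdg•(X, ℤ)) ⊆ Hdg•(X, ℤ)` for every `γ ∈ SL₂(ℤ)` on a principally
polarised complex torus (`T` by `η^{∧j}/j! ∧ ·` of type `(j, j)`, `S` by `w : Hdg^{2p}(X, ℤ) ⥲ Hdg^{2g−2p}(X, ℤ)`, row g51-#5).
[cite: Beauville2010SL2, §2 Proposition and §4 Theorem] [cite: Mukai1981, §3 Thm. 3.13]
[cite: Lange2023AbelianVarietiesComplex, §6.2.4 Prop. 6.2.20 p. 310, Prop. 6.2.21 p. 311; §7.2.2] [cite: Beauville1983FourierChow, §1 Prop. 1 (p. 241)] -/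
theorem IsPrincipalPolarization.sl2Rep_map_intCast_apply_mem_pi_iSup_integralHodgeClassesIn (hp : IsPrincipalPolarization Φ η)
    (hη : ∀ v : E, v ≠ 0 → ∃ w : E, η ![v, w] ≠ 0) (γ : SL(2, ℤ)) {w : GForm E ℂ}
    (hw : w ∈ AddSubgroup.pi Set.univ (fun m ↦ ⨆ p, integralHodgeClassesIn Φ m p)) :
    (hasLefschetzProperty_lefschetzG hη).sl2Rep isZGrading_countingG (γ : SL(2, ℂ)) w ∈
      AddSubgroup.pi Set.univ (fun m ↦ ⨆ p, integralHodgeClassesIn Φ m p) := by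
  have hNS : IsNSForm Φ η := hp.isRiemannForm.isNSForm
  have hS : ∀ w ∈ AddSubgroup.pi Set.univ (fun m ↦ ⨆ p, integralHodgeClassesIn Φ m p), (hasLefschetzProperty_lefschetzG hη).sl2Rep
      isZGrading_countingG ((ModularGroup.S : SL(2, ℤ)) : SL(2, ℂ)) w ∈ AddSubgroup.pi Set.univ (fun m ↦ ⨆ p, integralHodgeClassesIn Φ m p) :=
    fun w hw ↦ apply_mem_pi_iSup_integralHodgeClassesIn_of_forall_of Φ _
      (fun m i x hx ↦ hp.sl2Rep_of_mem_pi_iSup_integralHodgeClassesIn_of_coe_eq_weyl Φ hη _ coe_modularS₆₁ hx) hw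
  have hT : ∀ w ∈ AddSubgroup.pi Set.univ (fun m ↦ ⨆ p, integralHodgeClassesIn Φ m p), (hasLefschetzProperty_lefschetzG hη).sl2Rep
      isZGrading_countingG ((ModularGroup.T : SL(2, ℤ)) : SL(2, ℂ)) w ∈ AddSubgroup.pi Set.univ (fun m ↦ ⨆ p, integralHodgeClassesIn Φ m p) :=
    fun w hw ↦ apply_mem_pi_iSup_integralHodgeClassesIn_of_forall_of Φ _
      (fun m i x hx ↦ hNS.sl2Rep_of_mem_pi_iSup_integralHodgeClassesIn_of_coe_eq_upper Φ hη _ coe_modularT₆₁ hx) hw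
  have hmul : ∀ a b : SL(2, ℤ),
      (∀ w ∈ AddSubgroup.pi Set.univ (fun m ↦ ⨆ p, integralHodgeClassesIn Φ m p), (hasLefschetzProperty_lefschetzG hη).sl2Rep
        isZGrading_countingG (a : SL(2, ℂ)) w ∈ AddSubgroup.pi Set.univ (fun m ↦ ⨆ p, integralHodgeClassesIn Φ m p)) →
      (∀ w ∈ AddSubgroup.pi Set.univ (fun m ↦ ⨆ p, integralHodgeClassesIn Φ m p), (hasLefschetzProperty_lefschetzG hη).sl2Rep
        isZGrading_countingG (b : SL(2, ℂ)) w ∈ AddSubgroup.pi Set.univ (fun m ↦ ⨆ p, integralHodgeClassesIn Φ m p)) →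
      ∀ w ∈ AddSubgroup.pi Set.univ (fun m ↦ ⨆ p, integralHodgeClassesIn Φ m p), (hasLefschetzProperty_lefschetzG hη).sl2Rep
        isZGrading_countingG ((a * b : SL(2, ℤ)) : SL(2, ℂ)) w ∈ AddSubgroup.pi Set.univ (fun m ↦ ⨆ p, integralHodgeClassesIn Φ m p) :=
    fun a b ha hb w hw ↦ by
    rw [show ((a * b : SL(2, ℤ)) : SL(2, ℂ)) = (a : SL(2, ℂ)) * (b : SL(2, ℂ)) from map_mul _ a b, map_mul, Module.End.mul_apply]
    exact ha _ (hb w hw)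
  have hmem : γ ∈ Subgroup.closure {ModularGroup.S, ModularGroup.T} := by
    rw [SpecialLinearGroup.SL2Z_generators]; exact Subgroup.mem_top γ
  have key : ∀ w ∈ AddSubgroup.pi Set.univ (fun m ↦ ⨆ p, integralHodgeClassesIn Φ m p),
      (hasLefschetzProperty_lefschetzG hη).sl2Rep isZGrading_countingG (γ : SL(2, ℂ)) w ∈
        AddSubgroup.pi Set.univ (fun m ↦ ⨆ p, integralHodgeClassesIn Φ m p) := by
    refine Subgroup.closure_induction'' (p := fun (γ : SL(2, ℤ)) _ ↦ ∀ w ∈ AddSubgroup.pi Set.univ (fun m ↦ ⨆ p, integralHodgeClassesIn Φ m p),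
        (hasLefschetzProperty_lefschetzG hη).sl2Rep isZGrading_countingG (γ : SL(2, ℂ)) w ∈
          AddSubgroup.pi Set.univ (fun m ↦ ⨆ p, integralHodgeClassesIn Φ m p))
      ?_ ?_ ?_ (fun a b _ _ ha hb ↦ hmul a b ha hb) hmem
    · rintro γ (rfl | rfl)
      · exact hS
      · exact hT
    · rintro γ (rfl | rfl)
      · rw [modular_inv_words₆₁.1]; exact hmul _ _ (hmul _ _ hS hS) hS
      · rw [modular_inv_words₆₁.2]; exact hmul _ _ (hmul _ _ (hmul _ _ (hmul _ _ (hmul _ _ (hmul _ _ hS hS) hS) hT) hS) hT) hS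
    · intro w hw
      rw [show (((1 : SL(2, ℤ)) : SL(2, ℂ))) = 1 from map_one _, map_one, Module.End.one_apply]
      exact hw
  exact key w hw

/-- **Homogeneous form: `ρ(γ)(Hdg^p(X, ℤ)) ⊆ ⊕_q Hdg^q(X, ℤ)`** for every integral Hodge class of codimension `p` and every `γ ∈ SL₂(ℤ)` on a
principally polarised complex torus. [cite: Beauville2010SL2, §2 Proposition and §4 Theorem] [cite: Mukai1981, §3 Thm. 3.13]
[cite: Lange2023AbelianVarietiesComplex, §7.2.2] -/
theorem IsPrincipalPolarization.sl2Rep_map_intCast_of_mem_pi_iSup_integralHodgeClassesIn (hp : IsPrincipalPolarization Φ η)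
    (hη : ∀ v : E, v ≠ 0 → ∃ w : E, η ![v, w] ≠ 0) (γ : SL(2, ℤ)) {p : ℕ} {x : E [⋀^Fin (2 * p)]→L[ℝ] ℂ}
    (hx : x ∈ integralHodgeClasses Φ p) :
    (hasLefschetzProperty_lefschetzG hη).sl2Rep isZGrading_countingG (γ : SL(2, ℂ)) (GForm.of (2 * p) x) ∈
      AddSubgroup.pi Set.univ (fun m ↦ ⨆ p, integralHodgeClassesIn Φ m p) :=
  hp.sl2Rep_map_intCast_apply_mem_pi_iSup_integralHodgeClassesIn Φ hη γ (of_mem_pi_iSup_integralHodgeClassesIn Φ hx)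

/-- **Homogeneous form: `ρ(γ)(Hᵏ(X, ℤ)) ⊆ H•(X, ℤ)`** for every `γ ∈ SL₂(ℤ)` on a principally polarised complex torus.
[cite: Beauville2010SL2, §2 Proposition] [cite: Mukai1981, §3 Thm. 3.13] [cite: Lange2023AbelianVarietiesComplex, §6.2.4 Prop. 6.2.20 p. 310] -/
theorem IsPrincipalPolarization.sl2Rep_map_intCast_of_mem_pi_integralForms (hp : IsPrincipalPolarization Φ η)
    (hη : ∀ v : E, v ≠ 0 → ∃ w : E, η ![v, w] ≠ 0) (γ : SL(2, ℤ)) {k : ℕ} {x : E [⋀^Fin k]→L[ℝ] ℂ} (hx : x ∈ integralForms Φ k) :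
    (hasLefschetzProperty_lefschetzG hη).sl2Rep isZGrading_countingG (γ : SL(2, ℂ)) (GForm.of k x) ∈ AddSubgroup.pi Set.univ (integralForms Φ) :=
  hp.sl2Rep_map_intCast_apply_mem_pi_integralForms Φ hη γ (of_mem_pi_integralForms Φ hx)

end Modular

end ComplexTorus

end Literature.Geometry.Kaehler

end
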